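import Summits.QuantumFields.BalabanUV.Beta.FP.KernelPeriodisationFibLoc

/-!
# `BalabanUV.Beta.FP.KernelPeriodisationFibTrace` — road «FP» (binder row D1), RULING R-FP-51 row **(T-PER)**, PART 4 (owner's GO (P2), HOME/CLAIMS.log
# [D1P3-G16-GO-P1P2]): **THE TORUS-TRACE IDENTITY** — the trace of the periodised matrix of a diagonally periodised localised word is the sum over the
# period lattice of the SHIFTED DIAGONAL TRACES of the ℤ^{d+1} word, `trace (perF M (dper M X)) = Σ'_m trSh M X m` with `trSh M X 0 = tr X`; and the
# WRAP-AROUND estimate `|trace (perF M (dper M X)) − tr X| ≤ |F|·C·Zl(δ∕2)·K_{d+1}(δ∕2)·e^{(δ∕2)|p−q|₁}·e^{−(δ∕2)N}` for `M_i ≥ N ≥ 1`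

Supplier: road-P3 lineage `b2b-balaban-gan24-p3` (gen 31).  NOT IN PRINT; OUR BOOKKEEPING ([folklore] Fubini on `ℤ^{d+1} × ℤ^{d+1}` for exponentially
dominated families + the box × period-lattice unfolding of PART A).  One bookkeeping `def` (`trSh`), no `Prop` minted, nothing cited.
READING (the design sentence of [D1P3-G16-ROUTE-T], made a theorem): by PART 3's bimodule lemmas (`comp_dper_left` ∕ `comp_dper_right`) every word in
`Mℤ^{d+1}`-invariant decaying factors (resolvents, `dec`, units) with at least one diagonally periodised localised insertion is `dper M X` for the ℤ^{d+1} word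
`X` with ONE insertion un-periodised — a bi-localised kernel; §3 reads its torus trace as `Σ'_m trSh M X m`, whose `m = 0` term is the ℤ^{d+1} trace `tr X`
(still containing the other insertions' period sums — «the `Mℤ⁴`-periodisation of the ℤ⁴ word in the relative insertion point») and whose `m ≠ 0` terms are
the wrap-around, exponentially small in `min M_i` (§4).  The `M → ∞` step at fixed `j` is the owner's (T-DEPER) (leaf-05), consuming §3–§4 by name.
CONTENT.  §1 `trSh M X m := Σ'_x Σ_a X x (x + M∘m) a a`, `trSh_zero`.  §2 `trace_perF` (the torus trace of any periodised matrix, unfolded), the site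
unfolding `tsum_sites_eq_sum_tsum` (`Σ'_x G x = Σ_{r ∈ box} Σ'_k G (r + M∘k)`, PART A's `KernelPeriodisation.tsum_eq_sum_tsum` at one colour).  §3 the
dominated families of a bi-localised `X` (`summable_diag_translate`, `summable_uncurry_sites_lattice`, `summable_uncurry_lattice_lattice`) and
**`trace_perF_dper`**.  §4 **`abs_trace_perF_dper_sub_tr_le`** (wrap-around).  Moves NO (CONV-C) clause and NO row-D1 binder; NOT SDF, NOT D1, NOT BetaPertH,
NOT continuum, NOT Clay.  HONEST DEPENDENCY: continuum YM on T⁴ ⇐ BetaPertH ∧ nine spine estimates (0/9 proved); BetaPertH ⇐ (D1) ∧ (D4) ∧ CAP+tail;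
G-an2-4 gates asym, D1 and NE2/3/4.
-/

noncomputable section

open scoped BigOperators Matrix
open Finset

namespace Summit.QuantumFields.BalabanUV.Beta.FP.KernelPeriodisationFibTrace

open Literature.MathematicalPhysics.QuantumFieldTheory.Balaban1983to89
open Literature.MathematicalPhysics.QuantumFieldTheory.Balaban1983to89.Beta
open B12Sec2to5 (l1 l1_nonneg)
open B4TorusKernel.MultiPeriod (translate translate_apply translate_injective)
open B4Reflection242 (translate_translate)
open B4Sect5Proof (latticeConst latticeConst_nonneg)
open B6Lemma24Torus (pbox)
open ExpKernelCalculus (MKer Decays BiLoc tr l1_sub_triangle l1_sub_symm summable_exp_shift summable_exp_shift' tsum_exp_shift' Zl Zl_nonneg)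
open Summit.QuantumFields.BalabanUV.Beta.GAN24.KernelPeriodisation (tsum_eq_sum_tsum sh)
open Summit.QuantumFields.BalabanUV.Beta.GAN24.DirichletExhaustionQuadForm (amb)
open Summit.QuantumFields.BalabanUV.Beta.GAN24.DirichletExhaustionDeperiodise (translate_zero)
open Summit.QuantumFields.BalabanUV.Beta.FP.KernelPeriodisationFib (perZ perZ_apply perF perF_apply Idx translate_eq_add)
open Summit.QuantumFields.BalabanUV.Beta.FP.KernelPeriodisationFibLoc (dper dper_apply summable_exp_l1_translate exp_neg_add_le_left exp_neg_add_le_right)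

variable {d : ℕ} {F : Type*} [Fintype F]

/-! ## §1 Shifted diagonal traces -/

/-- **the `m`-SHIFTED DIAGONAL TRACE** of a kernel on `ℤ^{d+1}`: `trSh M X m = Σ'_x Σ_a X x (x + M∘m) a a` (`m = 0`: the trace). [our object] -/
def trSh (M : Fin (d + 1) → ℕ) (X : MKer (d + 1) F) (m : Fin (d + 1) → ℤ) : ℝ :=
  ∑' x : Fin (d + 1) → ℤ, ∑ a, X x (translate M x m) a a

/-- unfolding `trSh`. -/
theorem trSh_apply (M : Fin (d + 1) → ℕ) (X : MKer (d + 1) F) (m : Fin (d + 1) → ℤ) :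
    trSh M X m = ∑' x : Fin (d + 1) → ℤ, ∑ a, X x (translate M x m) a a := rfl

/-- `trSh M X 0 = tr X`. -/
theorem trSh_zero (M : Fin (d + 1) → ℕ) (X : MKer (d + 1) F) : trSh M X 0 = tr X := by
  simp only [trSh_apply, translate_zero, ExpKernelCalculus.tr]

/-! ## §2 The torus trace of a periodised matrix; unfolding site sums along box × period lattice -/

section Unfold

variable (M : Fin (d + 1) → ℕ) [∀ μ, NeZero (M μ)]

omit [∀ μ, NeZero (M μ)] in
/-- **the torus trace of `perF M W`, unfolded**: `trace (perF M W) = Σ_{r ∈ box} Σ_a perZ M W r r a a`. -/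
theorem trace_perF (W : MKer (d + 1) F) :
    Matrix.trace (perF M W) = ∑ r : ↥(pbox M), ∑ a : F, perZ M W (r : Fin (d + 1) → ℤ) (r : Fin (d + 1) → ℤ) a a := by
  rw [Matrix.trace, Fintype.sum_prod_type]
  rfl

/-- **UNFOLDING a site sum along the box and the period lattice**: `Σ'_x G x = Σ_{r ∈ box} Σ'_k G (r + M∘k)` for summable `G` (PART A's
`tsum_eq_sum_tsum` at one colour). [folklore] -/
theorem tsum_sites_eq_sum_tsum {G : (Fin (d + 1) → ℤ) → ℝ} (hG : Summable G) :
    ∑' x, G x = ∑ r : ↥(pbox M), ∑' k : Fin (d + 1) → ℤ, G (translate M (r : Fin (d + 1) → ℤ) k) := by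
  have hH : Summable fun s : B4Sect5Exhaustion.K (d + 1) 1 => G s.1 :=
    (Equiv.prodUnique (Fin (d + 1) → ℤ) (Fin 1)).summable_iff.2 hG
  have h1 : ∑' x, G x = ∑' s : B4Sect5Exhaustion.K (d + 1) 1, G s.1 :=
    ((Equiv.prodUnique (Fin (d + 1) → ℤ) (Fin 1)).tsum_eq G).symm
  rw [h1, tsum_eq_sum_tsum M hH, Fintype.sum_prod_type]
  refine Finset.sum_congr rfl fun r _ => ?_
  rw [Fin.sum_univ_one]
  rfl

end Unfold

/-! ## §3 The dominated families of a bi-localised kernel and the torus-trace identity -/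

section Main

variable (M : Fin (d + 1) → ℕ) [∀ μ, NeZero (M μ)]
variable {X : MKer (d + 1) F} {p q : Fin (d + 1) → ℤ} {C δ : ℝ}

omit [Fintype F] [∀ μ, NeZero (M μ)] in
/-- a bi-localised kernel along a shifted diagonal: `|X x (x+M∘m) a b| ≤ C·e^{−δ|x−p|₁}·e^{−δ|x+M∘m−q|₁}`. -/
theorem abs_diag_translate_le (hX : BiLoc X p q C δ) (x m : Fin (d + 1) → ℤ) (a b : F) :
    |X x (translate M x m) a b| ≤ C * Real.exp (-δ * l1 (x - p)) * Real.exp (-δ * l1 (translate M x m - q)) := by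
  refine (hX _ _ a b).trans (le_of_eq ?_)
  rw [mul_add, Real.exp_add, mul_assoc]

omit [Fintype F] in
/-- … summable along the period lattice, with `Σ'_m |·| ≤ C·K_{d+1}(δ)·e^{−δ|x−p|₁}`. -/
theorem summable_diag_translate (hX : BiLoc X p q C δ) (hC : 0 ≤ C) (hδ : 0 < δ) (x : Fin (d + 1) → ℤ) (a b : F) :
    Summable (fun m : Fin (d + 1) → ℤ => X x (translate M x m) a b) ∧
      ∑' m : Fin (d + 1) → ℤ, |X x (translate M x m) a b| ≤ C * latticeConst (d + 1) δ * Real.exp (-δ * l1 (x - p)) := by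
  obtain ⟨hs, hle⟩ := summable_exp_l1_translate M hδ q x
  have hmaj := hs.mul_left (C * Real.exp (-δ * l1 (x - p)))
  have hterm : ∀ m, |X x (translate M x m) a b| ≤ C * Real.exp (-δ * l1 (x - p)) * Real.exp (-δ * l1 (translate M x m - q)) :=
    fun m => abs_diag_translate_le M hX x m a b
  have habs : Summable fun m : Fin (d + 1) → ℤ => |X x (translate M x m) a b| :=
    hmaj.of_nonneg_of_le (fun m => abs_nonneg _) hterm
  refine ⟨habs.of_abs, (habs.tsum_le_tsum hterm hmaj).trans ?_⟩
  rw [tsum_mul_left]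
  calc C * Real.exp (-δ * l1 (x - p)) * ∑' m : Fin (d + 1) → ℤ, Real.exp (-δ * l1 (translate M x m - q))
      ≤ C * Real.exp (-δ * l1 (x - p)) * latticeConst (d + 1) δ := mul_le_mul_of_nonneg_left hle (by positivity)
    _ = C * latticeConst (d + 1) δ * Real.exp (-δ * l1 (x - p)) := by ring

omit [Fintype F] in
/-- the family `(x, m) ↦ X x (x + M∘m) a b` is summable on `sites × lattice`. -/
theorem summable_uncurry_sites_lattice (hX : BiLoc X p q C δ) (hC : 0 ≤ C) (hδ : 0 < δ) (a b : F) :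
    Summable (Function.uncurry fun (x m : Fin (d + 1) → ℤ) => X x (translate M x m) a b) := by
  have hg : Summable fun xm : (Fin (d + 1) → ℤ) × (Fin (d + 1) → ℤ) => |X xm.1 (translate M xm.1 xm.2) a b| := by
    refine (summable_prod_of_nonneg fun xm => abs_nonneg _).2 ⟨fun x => ?_, ?_⟩
    · exact ((summable_diag_translate M hX hC hδ x a b).1).abs
    · refine ((summable_exp_shift hδ p).mul_left (C * latticeConst (d + 1) δ)).of_nonneg_of_le
        (fun x => tsum_nonneg fun m => abs_nonneg _) fun x => ?_
      rw [l1_sub_symm p x]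
      exact (summable_diag_translate M hX hC hδ x a b).2
  refine hg.of_norm_bounded fun xm => ?_
  rw [Real.norm_eq_abs, Function.uncurry_apply_pair]

omit [Fintype F] in
/-- the family `(k, m) ↦ X (r + M∘k) (r + M∘k + M∘m) a b` is summable on `lattice × lattice` (the copies of the box point `r`). -/
theorem summable_uncurry_lattice_lattice (hX : BiLoc X p q C δ) (hC : 0 ≤ C) (hδ : 0 < δ) (r : Fin (d + 1) → ℤ) (a b : F) :
    Summable (Function.uncurry fun (k m : Fin (d + 1) → ℤ) => X (translate M r k) (translate M (translate M r k) m) a b) := by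
  have hg : Summable fun km : (Fin (d + 1) → ℤ) × (Fin (d + 1) → ℤ) =>
      |X (translate M r km.1) (translate M (translate M r km.1) km.2) a b| := by
    refine (summable_prod_of_nonneg fun km => abs_nonneg _).2 ⟨fun k => ?_, ?_⟩
    · exact ((summable_diag_translate M hX hC hδ (translate M r k) a b).1).abs
    · refine (((summable_exp_l1_translate M hδ p r).1).mul_left (C * latticeConst (d + 1) δ)).of_nonneg_of_le
        (fun k => tsum_nonneg fun m => abs_nonneg _) fun k => ?_
      exact (summable_diag_translate M hX hC hδ (translate M r k) a b).2
  refine hg.of_norm_bounded fun km => ?_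
  rw [Real.norm_eq_abs, Function.uncurry_apply_pair]

omit [Fintype F] in
/-- the site family `x ↦ Σ'_m X x (x + M∘m) a b` is summable. -/
theorem summable_tsum_diag (hX : BiLoc X p q C δ) (hC : 0 ≤ C) (hδ : 0 < δ) (a b : F) :
    Summable fun x : Fin (d + 1) → ℤ => ∑' m : Fin (d + 1) → ℤ, X x (translate M x m) a b :=
  (summable_uncurry_sites_lattice M hX hC hδ a b).prod

omit [Fintype F] in
/-- the lattice family `m ↦ Σ'_x X x (x + M∘m) a b` is summable. -/
theorem summable_tsum_diag' (hX : BiLoc X p q C δ) (hC : 0 ≤ C) (hδ : 0 < δ) (a b : F) :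
    Summable fun m : Fin (d + 1) → ℤ => ∑' x : Fin (d + 1) → ℤ, X x (translate M x m) a b :=
  (summable_uncurry_sites_lattice M hX hC hδ a b).prod_symm.prod

omit [∀ μ, NeZero (M μ)] in
/-- two translates commute: `(r + M∘m) + M∘k = (r + M∘k) + M∘m`. -/
theorem translate_comm (r m k : Fin (d + 1) → ℤ) : translate M (translate M r m) k = translate M (translate M r k) m := by
  rw [translate_translate, translate_translate, add_comm m k]

/-- **`trace_perF_dper` — THE TORUS-TRACE IDENTITY**: for a bi-localised `X` on `ℤ^{d+1}`, the trace of the periodised matrix of its diagonal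
periodisation is the sum of its shifted diagonal traces over the period lattice: `trace (perF M (dper M X)) = Σ'_m trSh M X m` (`m = 0`: `tr X`;
`m ≠ 0`: the wrap-around, §4). [folklore] -/
theorem trace_perF_dper (hX : BiLoc X p q C δ) (hδ : 0 < δ) :
    Matrix.trace (perF M (dper M X)) = ∑' m : Fin (d + 1) → ℤ, trSh M X m := by
  rcases isEmpty_or_nonempty F with hF | ⟨⟨a₀⟩⟩
  · rw [trace_perF]
    simp only [Finset.univ_eq_empty, Finset.sum_empty, Finset.sum_const_zero, trSh_apply, tsum_zero]
  have hC : 0 ≤ C := hX.nonneg a₀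
  have key : ∀ a : F, ∑ r : ↥(pbox M), perZ M (dper M X) (r : Fin (d + 1) → ℤ) (r : Fin (d + 1) → ℤ) a a =
      ∑' m : Fin (d + 1) → ℤ, ∑' x : Fin (d + 1) → ℤ, X x (translate M x m) a a := by
    intro a
    calc ∑ r : ↥(pbox M), perZ M (dper M X) (r : Fin (d + 1) → ℤ) (r : Fin (d + 1) → ℤ) a a
        = ∑ r : ↥(pbox M), ∑' m : Fin (d + 1) → ℤ, ∑' k : Fin (d + 1) → ℤ,
            X (translate M (r : Fin (d + 1) → ℤ) k) (translate M (translate M (r : Fin (d + 1) → ℤ) k) m) a a := by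
          refine Finset.sum_congr rfl fun r _ => ?_
          simp only [perZ_apply, dper_apply, translate_comm M (r : Fin (d + 1) → ℤ)]
      _ = ∑ r : ↥(pbox M), ∑' k : Fin (d + 1) → ℤ, ∑' m : Fin (d + 1) → ℤ,
            X (translate M (r : Fin (d + 1) → ℤ) k) (translate M (translate M (r : Fin (d + 1) → ℤ) k) m) a a := by
          refine Finset.sum_congr rfl fun r _ => ?_
          exact (summable_uncurry_lattice_lattice M hX hC hδ (r : Fin (d + 1) → ℤ) a a).tsum_comm
      _ = ∑' x : Fin (d + 1) → ℤ, ∑' m : Fin (d + 1) → ℤ, X x (translate M x m) a a :=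
          (tsum_sites_eq_sum_tsum M (summable_tsum_diag M hX hC hδ a a)).symm
      _ = ∑' m : Fin (d + 1) → ℤ, ∑' x : Fin (d + 1) → ℤ, X x (translate M x m) a a :=
          (summable_uncurry_sites_lattice M hX hC hδ a a).prod_symm.tsum_comm
  rw [trace_perF, Finset.sum_comm]
  calc ∑ a : F, ∑ r : ↥(pbox M), perZ M (dper M X) (r : Fin (d + 1) → ℤ) (r : Fin (d + 1) → ℤ) a a
      = ∑ a : F, ∑' m : Fin (d + 1) → ℤ, ∑' x : Fin (d + 1) → ℤ, X x (translate M x m) a a := Finset.sum_congr rfl fun a _ => key a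
    _ = ∑' m : Fin (d + 1) → ℤ, ∑ a : F, ∑' x : Fin (d + 1) → ℤ, X x (translate M x m) a a :=
        (Summable.tsum_finsetSum fun a _ => summable_tsum_diag' M hX hC hδ a a).symm
    _ = ∑' m : Fin (d + 1) → ℤ, trSh M X m := by
        refine tsum_congr fun m => ?_
        rw [trSh_apply, Summable.tsum_finsetSum fun a _ => ?_]
        exact (summable_uncurry_sites_lattice M hX hC hδ a a).prod_symm.prod_factor m

end Main

/-! ## §4 The wrap-around estimate -/

section Wrap

variable (M : Fin (d + 1) → ℕ) [∀ μ, NeZero (M μ)]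
variable {X : MKer (d + 1) F} {p q : Fin (d + 1) → ℤ} {C δ : ℝ}

omit [∀ μ, NeZero (M μ)] in
/-- a NONZERO period-lattice vector has `ℓ¹`-length `≥ N` when all periods are `≥ N`. -/
theorem le_l1_Mmul {N : ℕ} (hMN : ∀ i, N ≤ M i) {m : Fin (d + 1) → ℤ} (hm : m ≠ 0) :
    (N : ℝ) ≤ l1 (fun i => (M i : ℤ) * m i) := by
  obtain ⟨j, hj⟩ : ∃ j, m j ≠ 0 := Function.ne_iff.1 hm
  unfold l1
  refine le_trans ?_ (Finset.single_le_sum (f := fun i => |(((fun i => (M i : ℤ) * m i) i : ℤ) : ℝ)|) (fun i _ => abs_nonneg _)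
    (Finset.mem_univ j))
  have h1 : (1 : ℝ) ≤ |((m j : ℤ) : ℝ)| := by exact_mod_cast Int.one_le_abs hj
  have h2 : (N : ℝ) ≤ (M j : ℝ) := by exact_mod_cast hMN j
  rw [Int.cast_mul, abs_mul, Int.cast_natCast, Nat.abs_cast]
  nlinarith [Nat.cast_nonneg (α := ℝ) (M j)]

omit [∀ μ, NeZero (M μ)] in
/-- the shift vector as a difference: `(x + M∘m) − x = M∘m`. -/
theorem translate_sub_self (x m : Fin (d + 1) → ℤ) : translate M x m - x = fun i => (M i : ℤ) * m i := by
  rw [translate_eq_add]; abel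

omit [∀ μ, NeZero (M μ)] in
/-- the two localisation distances of a WRAPPED diagonal entry add up to at least `N − |p−q|₁`:
`|x−p|₁ + |x+M∘m−q|₁ ≥ N − |p−q|₁` for `m ≠ 0`, `M_i ≥ N`. -/
theorem le_l1_add_l1_of_ne_zero {N : ℕ} (hMN : ∀ i, N ≤ M i) (x : Fin (d + 1) → ℤ) {m : Fin (d + 1) → ℤ} (hm : m ≠ 0) :
    (N : ℝ) - l1 (p - q) ≤ l1 (x - p) + l1 (translate M x m - q) := by
  have h0 := le_l1_Mmul M hMN hm
  rw [← translate_sub_self M x m] at h0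
  have h1 : l1 (translate M x m - x) ≤ l1 (translate M x m - q) + l1 (q - x) := l1_sub_triangle _ _ _
  have h2 : l1 (q - x) ≤ l1 (q - p) + l1 (p - x) := l1_sub_triangle _ _ _
  rw [l1_sub_symm q p, l1_sub_symm p x] at h2
  linarith

omit [Fintype F] [∀ μ, NeZero (M μ)] in
/-- termwise wrap-around bound: for `m ≠ 0`, `|X x (x+M∘m) a b| ≤ C·e^{(δ∕2)|p−q|₁}·e^{−(δ∕2)N}·e^{−(δ∕2)|x−p|₁}·e^{−(δ∕2)|x+M∘m−q|₁}`. -/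
theorem abs_diag_translate_le_of_ne_zero (hX : BiLoc X p q C δ) (hC : 0 ≤ C) (hδ : 0 ≤ δ) {N : ℕ} (hMN : ∀ i, N ≤ M i)
    (x : Fin (d + 1) → ℤ) {m : Fin (d + 1) → ℤ} (hm : m ≠ 0) (a b : F) :
    |X x (translate M x m) a b| ≤ C * Real.exp (δ / 2 * l1 (p - q)) * Real.exp (-(δ / 2 * N)) *
      (Real.exp (-(δ / 2) * l1 (x - p)) * Real.exp (-(δ / 2) * l1 (translate M x m - q))) := by
  refine (hX _ _ a b).trans ?_
  have hgeo := le_l1_add_l1_of_ne_zero M (p := p) (q := q) hMN x hm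
  rw [mul_assoc, mul_assoc, ← Real.exp_add, ← Real.exp_add, ← Real.exp_add]
  refine mul_le_mul_of_nonneg_left (Real.exp_le_exp.2 ?_) hC
  nlinarith [l1_nonneg (x - p), l1_nonneg (translate M x m - q)]

/-- the explicit dominating family `(x, m) ↦ e^{−(δ∕2)|x−p|₁}·e^{−(δ∕2)|x+M∘m−q|₁}`: summable on `sites × lattice`, total `≤ Zl(δ∕2)·K_{d+1}(δ∕2)`. -/
theorem summable_expPair (hδ : 0 < δ) (p q : Fin (d + 1) → ℤ) :
    Summable (fun xm : (Fin (d + 1) → ℤ) × (Fin (d + 1) → ℤ) =>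
        Real.exp (-(δ / 2) * l1 (xm.1 - p)) * Real.exp (-(δ / 2) * l1 (translate M xm.1 xm.2 - q))) ∧
      ∑' xm : (Fin (d + 1) → ℤ) × (Fin (d + 1) → ℤ),
          Real.exp (-(δ / 2) * l1 (xm.1 - p)) * Real.exp (-(δ / 2) * l1 (translate M xm.1 xm.2 - q)) ≤
        Zl (d + 1) (δ / 2) * latticeConst (d + 1) (δ / 2) := by
  have hδ2 : 0 < δ / 2 := half_pos hδ
  have hin : ∀ x : Fin (d + 1) → ℤ, Summable (fun m : Fin (d + 1) → ℤ =>
      Real.exp (-(δ / 2) * l1 (x - p)) * Real.exp (-(δ / 2) * l1 (translate M x m - q))) ∧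
      ∑' m : Fin (d + 1) → ℤ, Real.exp (-(δ / 2) * l1 (x - p)) * Real.exp (-(δ / 2) * l1 (translate M x m - q)) ≤
        Real.exp (-(δ / 2) * l1 (x - p)) * latticeConst (d + 1) (δ / 2) := fun x => by
    obtain ⟨hs, hle⟩ := summable_exp_l1_translate M hδ2 q x
    refine ⟨hs.mul_left _, ?_⟩
    rw [tsum_mul_left]
    exact mul_le_mul_of_nonneg_left hle (Real.exp_pos _).le
  have hout : Summable fun x : Fin (d + 1) → ℤ => Real.exp (-(δ / 2) * l1 (x - p)) * latticeConst (d + 1) (δ / 2) :=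
    (summable_exp_shift' hδ2 p).mul_right _
  have hprod : Summable (fun xm : (Fin (d + 1) → ℤ) × (Fin (d + 1) → ℤ) =>
      Real.exp (-(δ / 2) * l1 (xm.1 - p)) * Real.exp (-(δ / 2) * l1 (translate M xm.1 xm.2 - q))) := by
    refine (summable_prod_of_nonneg fun xm => by positivity).2 ⟨fun x => (hin x).1, ?_⟩
    exact hout.of_nonneg_of_le (fun x => tsum_nonneg fun m => by positivity) fun x => (hin x).2
  refine ⟨hprod, ?_⟩
  rw [hprod.tsum_prod]
  calc ∑' x : Fin (d + 1) → ℤ, ∑' m : Fin (d + 1) → ℤ, Real.exp (-(δ / 2) * l1 (x - p)) * Real.exp (-(δ / 2) * l1 (translate M x m - q))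
      ≤ ∑' x : Fin (d + 1) → ℤ, Real.exp (-(δ / 2) * l1 (x - p)) * latticeConst (d + 1) (δ / 2) :=
        hprod.prod.tsum_le_tsum (fun x => (hin x).2) hout
    _ = Zl (d + 1) (δ / 2) * latticeConst (d + 1) (δ / 2) := by rw [tsum_mul_right, tsum_exp_shift']

/-- `trSh` as a finite sum of site sums (fibre components outside). -/
theorem trSh_eq_sum_tsum (hX : BiLoc X p q C δ) (hC : 0 ≤ C) (hδ : 0 < δ) (m : Fin (d + 1) → ℤ) :
    trSh M X m = ∑ a : F, ∑' x : Fin (d + 1) → ℤ, X x (translate M x m) a a := by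
  rw [trSh_apply, Summable.tsum_finsetSum fun a _ => ?_]
  exact (summable_uncurry_sites_lattice M hX hC hδ a a).prod_symm.prod_factor m

/-- the lattice family `m ↦ trSh M X m` is summable. -/
theorem summable_trSh (hX : BiLoc X p q C δ) (hC : 0 ≤ C) (hδ : 0 < δ) : Summable fun m : Fin (d + 1) → ℤ => trSh M X m := by
  have h : (fun m : Fin (d + 1) → ℤ => trSh M X m) = fun m => ∑ a : F, ∑' x : Fin (d + 1) → ℤ, X x (translate M x m) a a :=
    funext fun m => trSh_eq_sum_tsum M hX hC hδ m
  rw [h]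
  exact summable_sum fun a _ => summable_tsum_diag' M hX hC hδ a a

/-- the wrapped terms are dominated: for every `m`, `|ite (m = 0) 0 (trSh M X m)| ≤ |F|·C·e^{(δ∕2)|p−q|₁}·e^{−(δ∕2)N}·Σ'_x Φ(x, m)`. -/
theorem abs_ite_trSh_le (hX : BiLoc X p q C δ) (hC : 0 ≤ C) (hδ : 0 < δ) {N : ℕ} (hMN : ∀ i, N ≤ M i) (m : Fin (d + 1) → ℤ) :
    |(if m = 0 then (0 : ℝ) else trSh M X m)| ≤
      (Fintype.card F : ℝ) * C * Real.exp (δ / 2 * l1 (p - q)) * Real.exp (-(δ / 2 * N)) *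
        ∑' x : Fin (d + 1) → ℤ, Real.exp (-(δ / 2) * l1 (x - p)) * Real.exp (-(δ / 2) * l1 (translate M x m - q)) := by
  have hin := (summable_expPair M hδ p q).1.prod_symm.prod_factor m
  split_ifs with hm
  · rw [abs_zero]
    exact mul_nonneg (by positivity) (tsum_nonneg fun x => by positivity)
  · rw [trSh_apply]
    have hmaj := hin.mul_left ((Fintype.card F : ℝ) * C * Real.exp (δ / 2 * l1 (p - q)) * Real.exp (-(δ / 2 * N)))
    have hb := tsum_of_norm_bounded hmaj.hasSum fun x => by
      rw [Real.norm_eq_abs]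
      calc |∑ a, X x (translate M x m) a a| ≤ ∑ a, |X x (translate M x m) a a| := Finset.abs_sum_le_sum_abs _ _
        _ ≤ ∑ _a : F, C * Real.exp (δ / 2 * l1 (p - q)) * Real.exp (-(δ / 2 * N)) *
              (Real.exp (-(δ / 2) * l1 (x - p)) * Real.exp (-(δ / 2) * l1 (translate M x m - q))) :=
            Finset.sum_le_sum fun a _ => abs_diag_translate_le_of_ne_zero M hX hC hδ.le hMN x hm a a
        _ = (Fintype.card F : ℝ) * C * Real.exp (δ / 2 * l1 (p - q)) * Real.exp (-(δ / 2 * N)) *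
              (Real.exp (-(δ / 2) * l1 (x - p)) * Real.exp (-(δ / 2) * l1 (translate M x m - q))) := by
            rw [Finset.sum_const, Finset.card_univ, nsmul_eq_mul]; ring
    rw [Real.norm_eq_abs] at hb
    refine hb.trans (le_of_eq ?_)
    exact tsum_mul_left

/-- **`abs_trace_perF_dper_sub_tr_le` — THE WRAP-AROUND ESTIMATE**: for a bi-localised `X` (`BiLoc X p q C δ`, `δ > 0`) and periods `M_i ≥ N`,
`|trace (perF M (dper M X)) − tr X| ≤ |F|·C·e^{(δ∕2)|p−q|₁}·Zl(δ∕2)·K_{d+1}(δ∕2)·e^{−(δ∕2)N}`. [folklore] -/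
theorem abs_trace_perF_dper_sub_tr_le (hX : BiLoc X p q C δ) (hδ : 0 < δ) {N : ℕ} (hMN : ∀ i, N ≤ M i) :
    |Matrix.trace (perF M (dper M X)) - tr X| ≤
      (Fintype.card F : ℝ) * C * Real.exp (δ / 2 * l1 (p - q)) * (Zl (d + 1) (δ / 2) * latticeConst (d + 1) (δ / 2)) *
        Real.exp (-(δ / 2 * N)) := by
  classical
  rcases isEmpty_or_nonempty F with hF | ⟨⟨a₀⟩⟩
  · have h0 : Matrix.trace (perF M (dper M X)) = 0 := by
      rw [trace_perF]; simp only [Finset.univ_eq_empty, Finset.sum_empty, Finset.sum_const_zero]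
    have h1 : tr X = 0 := by
      simp only [ExpKernelCalculus.tr, Finset.univ_eq_empty, Finset.sum_empty, tsum_zero]
    rw [h0, h1, sub_zero, abs_zero, Fintype.card_eq_zero, Nat.cast_zero]
    simp
  have hC : 0 ≤ C := hX.nonneg a₀
  obtain ⟨hpair, hle⟩ := summable_expPair M hδ p q
  rw [trace_perF_dper M hX hδ, (summable_trSh M hX hC hδ).tsum_eq_add_tsum_ite 0, trSh_zero, add_sub_cancel_left]
  set E := (Fintype.card F : ℝ) * C * Real.exp (δ / 2 * l1 (p - q)) * Real.exp (-(δ / 2 * N)) with hE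
  have hE0 : 0 ≤ E := by rw [hE]; positivity
  have hg : Summable fun m : Fin (d + 1) → ℤ =>
      E * ∑' x : Fin (d + 1) → ℤ, Real.exp (-(δ / 2) * l1 (x - p)) * Real.exp (-(δ / 2) * l1 (translate M x m - q)) :=
    hpair.prod_symm.prod.mul_left E
  have hb := tsum_of_norm_bounded hg.hasSum fun m => by
    rw [Real.norm_eq_abs]; exact abs_ite_trSh_le M hX hC hδ hMN m
  rw [Real.norm_eq_abs] at hb
  refine hb.trans ?_
  rw [tsum_mul_left]
  have hcomm : ∑' (m : Fin (d + 1) → ℤ) (x : Fin (d + 1) → ℤ),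
      Real.exp (-(δ / 2) * l1 (x - p)) * Real.exp (-(δ / 2) * l1 (translate M x m - q)) =
      ∑' (x : Fin (d + 1) → ℤ) (m : Fin (d + 1) → ℤ), Real.exp (-(δ / 2) * l1 (x - p)) * Real.exp (-(δ / 2) * l1 (translate M x m - q)) :=
    Summable.tsum_comm (f := fun (x m : Fin (d + 1) → ℤ) =>
      Real.exp (-(δ / 2) * l1 (x - p)) * Real.exp (-(δ / 2) * l1 (translate M x m - q))) hpair
  have hprod := hpair.tsum_prod
  simp only at hprod
  rw [hcomm, ← hprod]
  calc E * ∑' xm : (Fin (d + 1) → ℤ) × (Fin (d + 1) → ℤ),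
        Real.exp (-(δ / 2) * l1 (xm.1 - p)) * Real.exp (-(δ / 2) * l1 (translate M xm.1 xm.2 - q))
      ≤ E * (Zl (d + 1) (δ / 2) * latticeConst (d + 1) (δ / 2)) := mul_le_mul_of_nonneg_left hle hE0
    _ = _ := by rw [hE]; ring

end Wrap

end Summit.QuantumFields.BalabanUV.Beta.FP.KernelPeriodisationFibTrace

end
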